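import Literature.MathematicalPhysics.PowerSystems.LuriePostnikovSlabCertificate
import Literature.Computation.Certificates.SemidefiniteRigorousBounds
import HarnessLib

/-!
# A dual witness for the slab/Popov certificate LMI: one PSD matrix ⇒ the certificate class is EMPTY

`LuriePostnikovSlabCertificate` packages a Lur'e–Postnikov certificate with slab sector bounds for
`ẋ = Ax − BF(Cx)` as the data `(P, ε, η, τ, λ, a, b)` subject to the conic constraints
`P − ε·1 ⪰ 0`, `ε, η > 0`, `τ ≥ 0`, `λ ≥ 0` (with `λ_k > 0 ⇒ a_k ≥ 0`) and ONE linear matrix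
inequality `−𝓛(P, η, λ, τ, a, b) ⪰ 0` (`slabMatrix`).  For FIXED sector slopes the map
`(P, η, λ, τ) ↦ 𝓛` is linear, so the existence of a certificate is the feasibility of a (mixed
strict / non-strict) conic system, and the textbook **theorem of weak alternatives** applies: a dual
conic point on which the Lagrangian is positive refutes feasibility
[BoydVandenberghe2004, §5.9.4 eqs. (5.96)–(5.98) and Example 5.14 (LMI feasibility)].

This module spells that dual point out for `slabMatrix` and proves the refutation in the kernel:

* `SlabDualWitness S a₀ b₀` — a matrix `Z = [[Z₁₁, Z₂₁ᵀ], [Z₂₁, Z₂₂]] ⪰ 0` on `ι ⊕ κ` with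
  (D1) the symmetrised adjoint image in the `P`-direction PSD:
       `W + Wᵀ ⪰ 0`, `W := Z₁₁Aᵀ + AZ₁₁ − 2·BZ₂₁`;
  (D2) the `τ_k`-coefficient nonnegative at the slopes `(a₀, b₀)`:
       `t_k := −a₀_k b₀_k (CZ₁₁Cᵀ)_kk + (a₀_k + b₀_k)(Z₂₁Cᵀ)_kk − (Z₂₂)_kk ≥ 0`;
  (D3) the `λ_k`-coefficient nonnegative on first/third-quadrant channels:
       `0 ≤ a₀_k ⇒ (Z₂₁(CA)ᵀ)_kk − (CBZ₂₂)_kk ≥ 0`;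
  (D4) `a₀_k < b₀_k` and `0 < tr Z₁₁`.
* `trace_dual_mul_slabMatrix` — the Lagrangian identity
  `tr(Z·𝓛) = tr(P·W) + η·tr Z₁₁ + Σ_k τ_k t_k(a, b) + 2 Σ_k λ_k s_k`.
* `SlabCertificate.false_of_dualWitness` — **no** `SlabCertificate S` has slopes `a ≤ a₀`, `b₀ ≤ b`
  (componentwise): for such a certificate `tr(Z·(−𝓛)) ≥ 0` (two PSD matrices), while the identity
  and (D1)–(D4) give `tr(Z·𝓛) ≥ η·tr Z₁₁ > 0`.  The passage from the witness slopes `(a₀, b₀)` to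
  every wider sector `a ≤ a₀`, `b₀ ≤ b` (`sectorCoeff_mono`) uses only `Z ⪰ 0` through the `2 × 2`
  compressions `s²(CZ₁₁Cᵀ)_kk + 2st(Z₂₁Cᵀ)_kk + t²(Z₂₂)_kk ≥ 0`.
* `SlabCertificate.false_of_dualWitness_of_window` — the form an instance uses: if the sector
  hypothesis `hsec` of `well_subset_regionOfAttraction` holds for a window `γ` and the window
  contains angles `ξa_k, ξb_k` with `cos ξa_k ≤ a₀_k`, `b₀_k ≤ cos ξb_k`, the certificate cannot
  exist; with `hsec` monotone in `γ` (`sector_hyp_mono`) ONE rational witness certifies that the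
  whole typed certificate class is EMPTY for every window `≥ γ` — the obstruction companion of a
  certified region (`WSCC9LossySlab*`), checkable by `decide` over `ℚ` exactly like the positive
  certificates (PSD facts by `PosSemidefDecide`, (D2)–(D4) by rational arithmetic).

No new facts: every statement below is a theorem.  Strong alternatives (existence of a witness
whenever the class is empty) are NOT claimed — producing `Z` is the SDP solver's job; the kernel
only checks it.

## References
* [BoydVandenberghe2004] S. Boyd, L. Vandenberghe, *Convex Optimization*, CUP 2004 — §5.9.4
  «Theorems of alternatives» (weak alternatives via the dual function, (5.96)–(5.98)) and
  Example 5.14 (feasibility of a linear matrix inequality) [held `book:boydnd-convex-optimization`,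
  chunks p0238–p0239].
* [Pai1981] M. A. Pai, *Power System Stability* (North-Holland 1981) — §2.16 eqs. (2.63)–(2.64)
  (the certificate equations typed as `slabMatrix`).
* [VuTuritsyn2017] T. L. Vu, K. Turitsyn, IEEE Trans. Power Syst. 32 (2017) — §4.2 Lemma 1.
* [JanssonChaykinKeil2008] (via `SemidefiniteRigorousBounds`) — `tr(PX) ≥ 0` for `P, X ⪰ 0`.
-/

open Matrix Finset

namespace Literature.MathematicalPhysics.PowerSystems.LyapunovFunctionFamily

variable {ι κ : Type*} [Fintype ι] [Fintype κ] [DecidableEq ι] [DecidableEq κ]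

/-! ## §1 Trace algebra helpers -/

section TraceAlgebra

omit [DecidableEq ι] [DecidableEq κ] in
/-- `tr([[A, B], [C, D]]·[[A', B'], [C', D']])`, block by block. [folklore] -/
private theorem trace_fromBlocks_mul_fromBlocks (A A' : Matrix ι ι ℝ) (B B' : Matrix ι κ ℝ)
    (C C' : Matrix κ ι ℝ) (D D' : Matrix κ κ ℝ) :
    trace (fromBlocks A B C D * fromBlocks A' B' C' D') =
      trace (A * A') + trace (B * C') + (trace (C * B') + trace (D * D')) := by
  rw [Matrix.fromBlocks_multiply]
  simp only [Matrix.trace, Matrix.diag_apply, Fintype.sum_sum_type, Matrix.fromBlocks_apply₁₁,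
    Matrix.fromBlocks_apply₂₂, Matrix.add_apply, Finset.sum_add_distrib]

omit [Fintype ι] [DecidableEq ι] in
/-- `tr(M·diag d) = Σ_k M_kk d_k`. [folklore] -/
private theorem trace_mul_diagonal (M : Matrix κ κ ℝ) (d : κ → ℝ) :
    trace (M * diagonal d) = ∑ k, M k k * d k := by
  simp only [Matrix.trace, Matrix.diag_apply, Matrix.mul_diagonal]

omit [Fintype ι] [DecidableEq ι] in
/-- `tr(diag d·M) = Σ_k d_k M_kk`. [folklore] -/
private theorem trace_diagonal_mul (d : κ → ℝ) (M : Matrix κ κ ℝ) :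
    trace (diagonal d * M) = ∑ k, d k * M k k := by
  simp only [Matrix.trace, Matrix.diag_apply, Matrix.diagonal_mul]

end TraceAlgebra

/-! ## §2 The dual functionals and the Lagrangian identity -/

section Lagrangian

variable (S : System ι κ)

/-- The adjoint image of the dual matrix in the `P`-direction: `W := Z₁₁Aᵀ + AZ₁₁ − 2·BZ₂₁`
(`tr(Z·𝓛)` depends on `P` through `tr(P·W)`).
[cite: BoydVandenberghe2004, §5.9.4 (the dual function of (5.96)) and Example 5.14] -/
def dualAdjP (Z₁₁ : Matrix ι ι ℝ) (Z₂₁ : Matrix κ ι ℝ) : Matrix ι ι ℝ :=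
  Z₁₁ * S.Aᵀ + S.A * Z₁₁ - (2 : ℝ) • (S.B * Z₂₁)

/-- The coefficient of the multiplier `τ_k` in `tr(Z·𝓛)` at slopes `(a, b)`:
`t_k(a, b) = −a_k b_k (CZ₁₁Cᵀ)_kk + (a_k + b_k)(Z₂₁Cᵀ)_kk − (Z₂₂)_kk`.
[cite: BoydVandenberghe2004, §5.9.4 (the dual function of (5.96)) and Example 5.14] -/
def dualSectorCoeff (Z₁₁ : Matrix ι ι ℝ) (Z₂₁ : Matrix κ ι ℝ) (Z₂₂ : Matrix κ κ ℝ)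
    (a b : κ → ℝ) (k : κ) : ℝ :=
  -(a k * b k) * (S.C * Z₁₁ * S.Cᵀ) k k + (a k + b k) * (Z₂₁ * S.Cᵀ) k k - Z₂₂ k k

/-- Half the coefficient of the Popov coefficient `λ_k` in `tr(Z·𝓛)`:
`s_k = (Z₂₁(CA)ᵀ)_kk − (CBZ₂₂)_kk`.
[cite: BoydVandenberghe2004, §5.9.4 (the dual function of (5.96)) and Example 5.14] -/
def dualPopovCoeff (Z₂₁ : Matrix κ ι ℝ) (Z₂₂ : Matrix κ κ ℝ) (k : κ) : ℝ :=
  (Z₂₁ * (S.C * S.A)ᵀ) k k - (S.C * S.B * Z₂₂) k k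

/-- State block: `tr(Z₁₁·L₁₁) = tr(P·(Z₁₁Aᵀ + AZ₁₁)) + η·tr Z₁₁ − Σ_k (CZ₁₁Cᵀ)_kk τ_k a_k b_k`. [folklore] -/
private theorem trace_mul_slabL11 (Z₁₁ P : Matrix ι ι ℝ) (η : ℝ) (τ a b : κ → ℝ) :
    trace (Z₁₁ * slabL11 S P η τ a b) =
      trace (P * (Z₁₁ * S.Aᵀ + S.A * Z₁₁)) + η * trace Z₁₁
        - ∑ k, (S.C * Z₁₁ * S.Cᵀ) k k * (τ k * (a k * b k)) := by
  have h1 : trace (Z₁₁ * (S.Aᵀ * P)) = trace (P * (Z₁₁ * S.Aᵀ)) := by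
    rw [← Matrix.mul_assoc, Matrix.trace_mul_comm]
  have h2 : trace (Z₁₁ * (P * S.A)) = trace (P * (S.A * Z₁₁)) := by
    rw [Matrix.trace_mul_comm, Matrix.mul_assoc]
  have h3 : trace (Z₁₁ * (S.Cᵀ * diagonal (fun k => τ k * (a k * b k)) * S.C)) =
      ∑ k, (S.C * Z₁₁ * S.Cᵀ) k k * (τ k * (a k * b k)) := by
    rw [show Z₁₁ * (S.Cᵀ * diagonal (fun k => τ k * (a k * b k)) * S.C) =
        (Z₁₁ * (S.Cᵀ * diagonal (fun k => τ k * (a k * b k)))) * S.C by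
          simp only [Matrix.mul_assoc],
      Matrix.trace_mul_comm,
      show S.C * (Z₁₁ * (S.Cᵀ * diagonal (fun k => τ k * (a k * b k)))) =
        (S.C * Z₁₁ * S.Cᵀ) * diagonal (fun k => τ k * (a k * b k)) by
          simp only [Matrix.mul_assoc],
      trace_mul_diagonal]
  simp only [slabL11, Matrix.mul_add, Matrix.mul_sub, Matrix.trace_add, Matrix.trace_sub, h1, h2,
    h3, Matrix.mul_smul, Matrix.mul_one, Matrix.trace_smul, smul_eq_mul]

omit [DecidableEq ι] in
/-- Cross block: `tr(Z₂₁·L₁₂) = −tr(P·BZ₂₁) + Σ_k (Z₂₁(CA)ᵀ)_kk λ_k + Σ_k (Z₂₁Cᵀ)_kk τ_k(a_k+b_k)/2`. [folklore] -/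
private theorem trace_mul_slabL12 (Z₂₁ : Matrix κ ι ℝ) (P : Matrix ι ι ℝ) (lam τ a b : κ → ℝ) :
    trace (Z₂₁ * slabL12 S P lam τ a b) =
      -trace (P * (S.B * Z₂₁)) + ∑ k, (Z₂₁ * (S.C * S.A)ᵀ) k k * lam k
        + ∑ k, (Z₂₁ * S.Cᵀ) k k * (τ k * (a k + b k) / 2) := by
  have h1 : trace (Z₂₁ * (P * S.B)) = trace (P * (S.B * Z₂₁)) := by
    rw [Matrix.trace_mul_comm, Matrix.mul_assoc]
  have h2 : trace (Z₂₁ * ((S.C * S.A)ᵀ * diagonal lam)) = ∑ k, (Z₂₁ * (S.C * S.A)ᵀ) k k * lam k := by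
    rw [← Matrix.mul_assoc, trace_mul_diagonal]
  have h3 : trace (Z₂₁ * (S.Cᵀ * diagonal (fun k => τ k * (a k + b k) / 2))) =
      ∑ k, (Z₂₁ * S.Cᵀ) k k * (τ k * (a k + b k) / 2) := by
    rw [← Matrix.mul_assoc, trace_mul_diagonal]
  simp only [slabL12, Matrix.mul_add, Matrix.mul_neg, Matrix.trace_add, Matrix.trace_neg, h1, h2, h3]

omit [DecidableEq ι] in
/-- Channel block (for symmetric `Z₂₂`):
`tr(Z₂₂·L₂₂) = −2 Σ_k λ_k (CBZ₂₂)_kk − Σ_k (Z₂₂)_kk τ_k`. [folklore] -/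
private theorem trace_mul_slabL22 (Z₂₂ : Matrix κ κ ℝ) (hZ : Z₂₂ᵀ = Z₂₂) (lam τ : κ → ℝ) :
    trace (Z₂₂ * slabL22 S lam τ) =
      -(2 * ∑ k, lam k * (S.C * S.B * Z₂₂) k k) - ∑ k, Z₂₂ k k * τ k := by
  have h1 : trace (Z₂₂ * (diagonal lam * (S.C * S.B))) = ∑ k, lam k * (S.C * S.B * Z₂₂) k k := by
    rw [Matrix.trace_mul_comm, Matrix.mul_assoc, trace_diagonal_mul]
  have h2 : trace (Z₂₂ * (diagonal lam * (S.C * S.B))ᵀ) = ∑ k, lam k * (S.C * S.B * Z₂₂) k k := by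
    rw [show Z₂₂ * (diagonal lam * (S.C * S.B))ᵀ = (diagonal lam * (S.C * S.B) * Z₂₂ᵀ)ᵀ by
          conv_rhs => rw [Matrix.transpose_mul, Matrix.transpose_transpose],
      Matrix.trace_transpose, hZ, Matrix.mul_assoc, trace_diagonal_mul]
  simp only [slabL22, Matrix.mul_sub, Matrix.mul_neg, Matrix.trace_sub, Matrix.trace_neg, h1, h2,
    trace_mul_diagonal]
  ring

/-- **The Lagrangian identity.** For blocks `Z₁₁, Z₂₁, Z₂₂` (`Z₂₂` symmetric) and any certificate
data, `tr([[Z₁₁, Z₂₁ᵀ], [Z₂₁, Z₂₂]]·𝓛) = tr(P·W) + η·tr Z₁₁ + Σ_k τ_k t_k(a, b) + 2 Σ_k λ_k s_k` —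
the dual function of the conic system «a certificate exists», evaluated termwise.
[cite: BoydVandenberghe2004, §5.9.4 (dual function of (5.96)–(5.97)) and Example 5.14 (`tr(F(x)Z)`)] -/
theorem trace_dual_mul_slabMatrix (Z₁₁ : Matrix ι ι ℝ) (Z₂₁ : Matrix κ ι ℝ) (Z₂₂ : Matrix κ κ ℝ)
    (hZ : Z₂₂ᵀ = Z₂₂) (P : Matrix ι ι ℝ) (η : ℝ) (lam τ a b : κ → ℝ) :
    trace (fromBlocks Z₁₁ Z₂₁ᵀ Z₂₁ Z₂₂ * slabMatrix S P η lam τ a b) =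
      trace (P * dualAdjP S Z₁₁ Z₂₁) + η * trace Z₁₁
        + ∑ k, τ k * dualSectorCoeff S Z₁₁ Z₂₁ Z₂₂ a b k
        + 2 * ∑ k, lam k * dualPopovCoeff S Z₂₁ Z₂₂ k := by
  have hcross : trace (Z₂₁ᵀ * (slabL12 S P lam τ a b)ᵀ) = trace (Z₂₁ * slabL12 S P lam τ a b) := by
    rw [← Matrix.transpose_mul, Matrix.trace_transpose, Matrix.trace_mul_comm]
  have hP : trace (P * dualAdjP S Z₁₁ Z₂₁) =
      trace (P * (Z₁₁ * S.Aᵀ + S.A * Z₁₁)) - 2 * trace (P * (S.B * Z₂₁)) := by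
    simp only [dualAdjP, Matrix.mul_sub, Matrix.mul_smul, Matrix.trace_sub, Matrix.trace_smul,
      smul_eq_mul]
  rw [slabMatrix, trace_fromBlocks_mul_fromBlocks, hcross, trace_mul_slabL11, trace_mul_slabL12,
    trace_mul_slabL22 S Z₂₂ hZ, hP]
  have hτ : ∑ k, τ k * dualSectorCoeff S Z₁₁ Z₂₁ Z₂₂ a b k =
      -∑ k, (S.C * Z₁₁ * S.Cᵀ) k k * (τ k * (a k * b k))
        + 2 * ∑ k, (Z₂₁ * S.Cᵀ) k k * (τ k * (a k + b k) / 2) - ∑ k, Z₂₂ k k * τ k := by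
    rw [Finset.mul_sum, ← Finset.sum_neg_distrib, ← Finset.sum_add_distrib,
      ← Finset.sum_sub_distrib]
    exact Finset.sum_congr rfl fun k _ => by simp only [dualSectorCoeff]; ring
  have hl : ∑ k, lam k * dualPopovCoeff S Z₂₁ Z₂₂ k =
      ∑ k, (Z₂₁ * (S.C * S.A)ᵀ) k k * lam k - ∑ k, lam k * (S.C * S.B * Z₂₂) k k := by
    rw [← Finset.sum_sub_distrib]
    exact Finset.sum_congr rfl fun k _ => by simp only [dualPopovCoeff]; ring
  rw [hτ, hl]
  ring

end Lagrangian

/-! ## §3 The witness and the emptiness theorem -/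

/-- **A dual witness against slab/Popov certificates with slopes `(a₀, b₀)`** for `ẋ = Ax − BF(Cx)`:
a positive semidefinite `Z = [[Z₁₁, Z₂₁ᵀ], [Z₂₁, Z₂₂]]` on `ι ⊕ κ` whose Lagrangian
`tr(Z·𝓛(P, η, λ, τ, a, b))` is `≥ η·tr Z₁₁ > 0` on the whole certificate cone: (D1) the
`P`-coefficient `W + Wᵀ ⪰ 0`, (D2) every `τ_k`-coefficient `t_k(a₀, b₀) ≥ 0`, (D3) every admissible
`λ_k`-coefficient `≥ 0`, (D4) `a₀ < b₀` and `tr Z₁₁ > 0`.  This is the point `λ ⪰_{K*} 0, λ ≠ 0,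
g(λ) ≥ 0` of the weak alternative to the strict conic system «a certificate exists», written out
for `slabMatrix`; all fields are decidable on rational data.
[cite: BoydVandenberghe2004, §5.9.4 eqs. (5.97)–(5.98) (weak alternatives) and Example 5.14 (LMI feasibility: `Z ⪰ 0, Z ≠ 0, tr(GZ) ≥ 0, tr(FᵢZ) = 0`)] -/
structure SlabDualWitness (S : System ι κ) (a₀ b₀ : κ → ℝ) where
  /-- state block of the dual matrix -/
  Z₁₁ : Matrix ι ι ℝ
  /-- channel × state block of the dual matrix -/
  Z₂₁ : Matrix κ ι ℝ
  /-- channel block of the dual matrix -/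
  Z₂₂ : Matrix κ κ ℝ
  /-- `Z ⪰ 0` -/
  psd : (fromBlocks Z₁₁ Z₂₁ᵀ Z₂₁ Z₂₂).PosSemidef
  /-- (D1) the symmetrised `P`-coefficient is PSD -/
  adjP_psd : (dualAdjP S Z₁₁ Z₂₁ + (dualAdjP S Z₁₁ Z₂₁)ᵀ).PosSemidef
  /-- (D2) the `τ_k`-coefficients at the witness slopes are nonnegative -/
  sectorCoeff_nonneg : ∀ k, 0 ≤ dualSectorCoeff S Z₁₁ Z₂₁ Z₂₂ a₀ b₀ k
  /-- (D3) the `λ_k`-coefficients are nonnegative on channels where Popov terms are admissible -/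
  popovCoeff_nonneg : ∀ k, 0 ≤ a₀ k → 0 ≤ dualPopovCoeff S Z₂₁ Z₂₂ k
  /-- (D4a) nondegenerate sectors -/
  slope_lt : ∀ k, a₀ k < b₀ k
  /-- (D4b) `Z ≠ 0` in the direction that meets the strict constraint `η > 0` -/
  trace_pos : 0 < trace Z₁₁

namespace SlabDualWitness

variable {S : System ι κ} {a₀ b₀ : κ → ℝ} (D : SlabDualWitness S a₀ b₀)

omit [DecidableEq ι] [DecidableEq κ] in
/-- `Z₂₂` is symmetric (a positive semidefinite matrix is Hermitian).
[cite: HornJohnson2013, §7.1 (7.1.1b) (positive semidefiniteness is a property of Hermitian matrices)] -/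
theorem Z₂₂_symm : D.Z₂₂ᵀ = D.Z₂₂ := by
  have h := (Matrix.isHermitian_fromBlocks_iff.mp D.psd.isHermitian).2.2.2
  simpa [Matrix.IsHermitian, Matrix.conjTranspose_eq_transpose_of_trivial] using h

omit [DecidableEq ι] in
/-- The `2 × 2` compressions of `Z ⪰ 0` along `x = (s·C_kᵀ, t·e_k)`:
`xᵀZx = s²(CZ₁₁Cᵀ)_kk + 2st(Z₂₁Cᵀ)_kk + t²(Z₂₂)_kk ≥ 0`.
[cite: HornJohnson2013, §7.1 (7.1.1b) (`x*Ax ≥ 0`) and Observation 7.1.8 (a) (`C*AC ⪰ 0`)] -/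
theorem compression_nonneg (k : κ) (s t : ℝ) :
    0 ≤ s * s * (S.C * D.Z₁₁ * S.Cᵀ) k k + 2 * s * t * (D.Z₂₁ * S.Cᵀ) k k
      + t * t * D.Z₂₂ k k := by
  have h := D.psd.dotProduct_mulVec_nonneg (Sum.elim (s • S.C k) (t • Pi.single k 1))
  rw [star_trivial, Matrix.fromBlocks_mulVec, Sum.elim_comp_inl, Sum.elim_comp_inr,
    sumElim_dotProduct_sumElim] at h
  have b1 : S.C k ⬝ᵥ (D.Z₁₁ *ᵥ S.C k) = (S.C * D.Z₁₁ * S.Cᵀ) k k := by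
    simp only [Matrix.mul_apply, Matrix.transpose_apply, dotProduct, Matrix.mulVec,
      Finset.mul_sum, Finset.sum_mul]
    rw [Finset.sum_comm]
    exact Finset.sum_congr rfl fun j _ => Finset.sum_congr rfl fun i _ => by ring
  have b2 : Pi.single k 1 ⬝ᵥ (D.Z₂₁ *ᵥ S.C k) = (D.Z₂₁ * S.Cᵀ) k k := by
    rw [single_one_dotProduct]
    simp only [Matrix.mulVec, dotProduct, Matrix.mul_apply, Matrix.transpose_apply]
  have b3 : S.C k ⬝ᵥ (D.Z₂₁ᵀ *ᵥ Pi.single k 1) = (D.Z₂₁ * S.Cᵀ) k k := by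
    rw [dotProduct_mulVec, dotProduct_single_one]
    simp only [Matrix.vecMul, dotProduct, Matrix.mul_apply, Matrix.transpose_apply, mul_comm]
  have b4 : Pi.single k 1 ⬝ᵥ (D.Z₂₂ *ᵥ Pi.single k 1) = D.Z₂₂ k k := by
    rw [single_one_dotProduct, Matrix.mulVec, dotProduct_single_one]
  have e : s • S.C k ⬝ᵥ (D.Z₁₁ *ᵥ (s • S.C k) + D.Z₂₁ᵀ *ᵥ (t • Pi.single k 1))
      + t • Pi.single k 1 ⬝ᵥ (D.Z₂₁ *ᵥ (s • S.C k) + D.Z₂₂ *ᵥ (t • Pi.single k 1))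
      = s * s * (S.C * D.Z₁₁ * S.Cᵀ) k k + 2 * s * t * (D.Z₂₁ * S.Cᵀ) k k
        + t * t * D.Z₂₂ k k := by
    simp only [Matrix.mulVec_smul, dotProduct_add, dotProduct_smul, smul_dotProduct, smul_eq_mul,
      b1, b2, b3, b4]
    ring
  linarith [h, e]

omit [DecidableEq ι] in
/-- `(CZ₁₁Cᵀ)_kk = C_k Z₁₁ C_kᵀ ≥ 0`. [cite: HornJohnson2013, §7.1 (7.1.1b) with `x = (C_kᵀ, 0)`] -/
theorem U_nonneg (k : κ) : 0 ≤ (S.C * D.Z₁₁ * S.Cᵀ) k k := by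
  have := D.compression_nonneg k 1 0
  linarith

omit [DecidableEq ι] in
/-- **Slope monotonicity of the sector coefficient.** From `Z ⪰ 0` and `t_k(a₀, b₀) ≥ 0` with
`a₀_k < b₀_k`: `t_k(a, b) ≥ 0` for every wider sector `a ≤ a₀_k`, `b₀_k ≤ b` — so one witness at the
innermost slopes refutes all certificates usable for the window.  (The compressions at
`(s, t) = (b₀_k, −1)` and `(a₀_k, −1)` added to `t_k(a₀, b₀)` give `(b₀_k − a₀_k)(b₀_k u − v) ≥ 0` and
`(b₀_k − a₀_k)(v − a₀_k u) ≥ 0`; then `t_k(a, b) − t_k(a₀, b₀) = q(v − a₀ u) + p(b₀ u − v) + u p q ≥ 0`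
for `a = a₀ − p`, `b = b₀ + q`.)
[cite: HornJohnson2013, §7.1 (7.1.1b) (the two compressions); BoydVandenberghe2004, §5.9.4 (5.98) (the dual point must be nonnegative against every primal cone direction — here every admissible sector)] -/
theorem sectorCoeff_mono (k : κ) {a b : κ → ℝ} (ha : a k ≤ a₀ k) (hb : b₀ k ≤ b k) :
    0 ≤ dualSectorCoeff S D.Z₁₁ D.Z₂₁ D.Z₂₂ a b k := by
  have ht := D.sectorCoeff_nonneg k
  have hlt := D.slope_lt k
  have hu := D.U_nonneg k
  have qb := D.compression_nonneg k (b₀ k) (-1)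
  have qa := D.compression_nonneg k (a₀ k) (-1)
  simp only [dualSectorCoeff] at ht ⊢
  set u := (S.C * D.Z₁₁ * S.Cᵀ) k k
  set v := (D.Z₂₁ * S.Cᵀ) k k
  set w := D.Z₂₂ k k
  have hgap : 0 < b₀ k - a₀ k := sub_pos.2 hlt
  have hy : 0 ≤ b₀ k * u - v := by
    have h1 : 0 ≤ (b₀ k - a₀ k) * (b₀ k * u - v) := by nlinarith
    by_contra hneg
    have h2 : (b₀ k - a₀ k) * (b₀ k * u - v) < 0 := mul_neg_of_pos_of_neg hgap (lt_of_not_ge hneg)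
    linarith
  have hx : 0 ≤ v - a₀ k * u := by
    have h1 : 0 ≤ (b₀ k - a₀ k) * (v - a₀ k * u) := by nlinarith
    by_contra hneg
    have h2 : (b₀ k - a₀ k) * (v - a₀ k * u) < 0 := mul_neg_of_pos_of_neg hgap (lt_of_not_ge hneg)
    linarith
  nlinarith [mul_nonneg (sub_nonneg.2 ha) (sub_nonneg.2 hb), mul_nonneg hx (sub_nonneg.2 hb),
    mul_nonneg hy (sub_nonneg.2 ha), mul_nonneg hu (mul_nonneg (sub_nonneg.2 ha) (sub_nonneg.2 hb))]

end SlabDualWitness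

namespace SlabCertificate

variable {S : System ι κ} (Λ : SlabCertificate S)

/-- `P ⪰ 0` for a certificate (`P = (P − ε·1) + ε·1`, `ε > 0`).
[cite: HornJohnson2013, Observation 7.1.3 (nonnegative combinations of positive semidefinite matrices)] -/
theorem posSemidef_P : Λ.P.PosSemidef := by
  have h := Λ.P_ge.add (Matrix.PosSemidef.one.smul Λ.ε_pos.le)
  simpa using h

/-- **The emptiness theorem (weak alternative).**  If a dual witness at slopes `(a₀, b₀)` exists, NO
slab/Popov certificate of the typed class has channel sectors `a_k ≤ a₀_k`, `b₀_k ≤ b_k`: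
`tr(Z·(−𝓛)) ≥ 0` because both matrices are PSD, whereas the Lagrangian identity with (D1)–(D4)
gives `tr(Z·𝓛) ≥ η·tr Z₁₁ > 0`.
[cite: BoydVandenberghe2004, §5.9.4 eqs. (5.97)–(5.98) and the displayed contradiction `0 < g(λ, ν) ≤ Σ λᵢᵀfᵢ(x) ≤ 0`; Example 5.14] -/
theorem false_of_dualWitness {a₀ b₀ : κ → ℝ} (D : SlabDualWitness S a₀ b₀)
    (ha : ∀ k, Λ.a k ≤ a₀ k) (hb : ∀ k, b₀ k ≤ Λ.b k) : False := by
  -- primal side: `tr(Z·𝓛) ≤ 0`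
  have hneg : trace (fromBlocks D.Z₁₁ D.Z₂₁ᵀ D.Z₂₁ D.Z₂₂ *
      slabMatrix S Λ.P Λ.η Λ.lam Λ.τ Λ.a Λ.b) ≤ 0 := by
    have h := Literature.Computation.Certificates.trace_mul_nonneg_of_posSemidef D.psd Λ.lmi
    rw [Matrix.mul_neg, Matrix.trace_neg] at h
    linarith
  -- dual side, term by term
  have hid := trace_dual_mul_slabMatrix S D.Z₁₁ D.Z₂₁ D.Z₂₂ D.Z₂₂_symm Λ.P Λ.η Λ.lam Λ.τ Λ.a Λ.b
  have hPW : 0 ≤ trace (Λ.P * dualAdjP S D.Z₁₁ D.Z₂₁) := by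
    have h2 := Literature.Computation.Certificates.trace_mul_nonneg_of_posSemidef Λ.posSemidef_P
      D.adjP_psd
    have hsym : trace (Λ.P * (dualAdjP S D.Z₁₁ D.Z₂₁)ᵀ) = trace (Λ.P * dualAdjP S D.Z₁₁ D.Z₂₁) := by
      rw [← Matrix.trace_transpose, Matrix.transpose_mul, Matrix.transpose_transpose, Λ.P_symm,
        Matrix.trace_mul_comm]
    rw [Matrix.mul_add, Matrix.trace_add, hsym] at h2
    linarith
  have hη : 0 < Λ.η * trace D.Z₁₁ := mul_pos Λ.η_pos D.trace_pos
  have hτ : 0 ≤ ∑ k, Λ.τ k * dualSectorCoeff S D.Z₁₁ D.Z₂₁ D.Z₂₂ Λ.a Λ.b k :=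
    Finset.sum_nonneg fun k _ => mul_nonneg (Λ.τ_nonneg k) (D.sectorCoeff_mono k (ha k) (hb k))
  have hl : 0 ≤ ∑ k, Λ.lam k * dualPopovCoeff S D.Z₂₁ D.Z₂₂ k := by
    refine Finset.sum_nonneg fun k _ => ?_
    rcases (Λ.lam_nonneg k).eq_or_lt with h0 | hpos
    · rw [← h0, zero_mul]
    · exact mul_nonneg hpos.le
        (D.popovCoeff_nonneg k ((Λ.a_nonneg_of_lam_pos k hpos).trans (ha k)))
  linarith

/-- Set form: the class of certificates with sectors at least `[a₀, b₀]` is EMPTY.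
[cite: BoydVandenberghe2004, §5.9.4 eqs. (5.97)–(5.98) and Example 5.14] -/
theorem isEmpty_of_dualWitness {a₀ b₀ : κ → ℝ} (D : SlabDualWitness S a₀ b₀) :
    IsEmpty {Λ : SlabCertificate S // (∀ k, Λ.a k ≤ a₀ k) ∧ ∀ k, b₀ k ≤ Λ.b k} :=
  ⟨fun ⟨Λ, ha, hb⟩ => Λ.false_of_dualWitness D ha hb⟩

/-- **Window form (what an instance states).**  If a certificate satisfied the sector hypothesis of
`well_subset_regionOfAttraction` for the window `γ`, and the window contains angles `ξa_k`, `ξb_k`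
with `cos ξa_k ≤ a₀_k` and `b₀_k ≤ cos ξb_k` (closed rational inequalities an instance discharges by
interval facts), then a dual witness at `(a₀, b₀)` refutes it: the receptacle's hypothesis is
UNSATISFIABLE by the typed certificate class for this window (and, the hypothesis being monotone
in `γ`, for every wider window).
[cite: BoydVandenberghe2004, §5.9.4 eqs. (5.97)–(5.98) and Example 5.14; Pai1981, §4.6 p. 117 (sector region of the power nonlinearity)] -/
theorem false_of_dualWitness_of_window {a₀ b₀ : κ → ℝ} (D : SlabDualWitness S a₀ b₀) {γ : κ → ℝ}
    (hsec : ∀ k ξ, |ξ - S.δs k| ≤ γ k → Λ.a k ≤ Real.cos ξ ∧ Real.cos ξ ≤ Λ.b k)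
    (ξa ξb : κ → ℝ) (hξa : ∀ k, |ξa k - S.δs k| ≤ γ k) (hξb : ∀ k, |ξb k - S.δs k| ≤ γ k)
    (hca : ∀ k, Real.cos (ξa k) ≤ a₀ k) (hcb : ∀ k, b₀ k ≤ Real.cos (ξb k)) : False :=
  Λ.false_of_dualWitness D (fun k => ((hsec k (ξa k) (hξa k)).1).trans (hca k))
    (fun k => (hcb k).trans (hsec k (ξb k) (hξb k)).2)

end SlabCertificate

/-! ## §4 Null channels (APPEND 2026-08-27, lit-6 g6): no slope hypothesis is needed on a channel the
witness does not see

On a channel `k` whose four dual functionals vanish — `(CZ₁₁Cᵀ)_kk = (Z₂₁Cᵀ)_kk = (Z₂₂)_kk = 0` and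
`s_k = 0` (e.g. a weightless diagonal channel `(p, p)` of a directed presentation, where the `k`-th row
of `C` and the `k`-th row/column of `Z₂₁`, `Z₂₂` are zero) — the `τ_k`- and `λ_k`-terms of the
Lagrangian vanish for EVERY sector `[a_k, b_k]`, so the emptiness theorem needs the slope hypotheses
`a_k ≤ a₀_k`, `b₀_k ≤ b_k` (equivalently, window points) only on the remaining channels.  This spares an
instance the enclosure of the equilibrium angle of channels that carry no weight. -/

namespace SlabDualWitness

variable {S : System ι κ} {a₀ b₀ : κ → ℝ} (D : SlabDualWitness S a₀ b₀)

/-- Channel `k` is NULL for the witness: its four dual functionals vanish (decidable on rational data).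
[cite: BoydVandenberghe2004, §5.9.4 (5.98) (components of the dual point may vanish; the weak alternative only needs `λ ⪰_{K*} 0`, `λ ≠ 0`)] -/
def IsNull (k : κ) : Prop :=
  (S.C * D.Z₁₁ * S.Cᵀ) k k = 0 ∧ (D.Z₂₁ * S.Cᵀ) k k = 0 ∧ D.Z₂₂ k k = 0 ∧
    dualPopovCoeff S D.Z₂₁ D.Z₂₂ k = 0

omit [DecidableEq ι] [DecidableEq κ] in
/-- On a null channel the `τ_k`-coefficient vanishes for every sector.
[cite: BoydVandenberghe2004, §5.9.4 (5.98)] -/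
theorem sectorCoeff_eq_zero_of_isNull {k : κ} (h : D.IsNull k) (a b : κ → ℝ) :
    dualSectorCoeff S D.Z₁₁ D.Z₂₁ D.Z₂₂ a b k = 0 := by
  obtain ⟨hu, hv, hw, -⟩ := h
  simp only [dualSectorCoeff, hu, hv, hw, mul_zero, add_zero, sub_zero]

omit [DecidableEq ι] in
/-- The `τ_k`-term of the Lagrangian is nonnegative on every channel that is either null or carries a
sector at least `[a₀_k, b₀_k]`. [cite: BoydVandenberghe2004, §5.9.4 (5.98); HornJohnson2013, §7.1 (7.1.1b)] -/
theorem sectorCoeff_nonneg_of_null_or_slopes (k : κ) {a b : κ → ℝ}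
    (h : D.IsNull k ∨ (a k ≤ a₀ k ∧ b₀ k ≤ b k)) :
    0 ≤ dualSectorCoeff S D.Z₁₁ D.Z₂₁ D.Z₂₂ a b k := by
  rcases h with h | ⟨ha, hb⟩
  · rw [D.sectorCoeff_eq_zero_of_isNull h]
  · exact D.sectorCoeff_mono k ha hb

end SlabDualWitness

namespace SlabCertificate

variable {S : System ι κ} (Λ : SlabCertificate S)

/-- **The emptiness theorem with null channels.**  If a dual witness at slopes `(a₀, b₀)` exists and
every channel is either NULL for the witness or carries a certificate sector `a_k ≤ a₀_k`, `b₀_k ≤ b_k`,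
the certificate cannot exist (same Lagrangian argument; the null channels contribute `0`).
[cite: BoydVandenberghe2004, §5.9.4 eqs. (5.97)–(5.98) and Example 5.14] -/
theorem false_of_dualWitness_of_null {a₀ b₀ : κ → ℝ} (D : SlabDualWitness S a₀ b₀)
    (hab : ∀ k, D.IsNull k ∨ (Λ.a k ≤ a₀ k ∧ b₀ k ≤ Λ.b k)) : False := by
  have hneg : trace (fromBlocks D.Z₁₁ D.Z₂₁ᵀ D.Z₂₁ D.Z₂₂ *
      slabMatrix S Λ.P Λ.η Λ.lam Λ.τ Λ.a Λ.b) ≤ 0 := by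
    have h := Literature.Computation.Certificates.trace_mul_nonneg_of_posSemidef D.psd Λ.lmi
    rw [Matrix.mul_neg, Matrix.trace_neg] at h
    linarith
  have hid := trace_dual_mul_slabMatrix S D.Z₁₁ D.Z₂₁ D.Z₂₂ D.Z₂₂_symm Λ.P Λ.η Λ.lam Λ.τ Λ.a Λ.b
  have hPW : 0 ≤ trace (Λ.P * dualAdjP S D.Z₁₁ D.Z₂₁) := by
    have h2 := Literature.Computation.Certificates.trace_mul_nonneg_of_posSemidef Λ.posSemidef_P
      D.adjP_psd
    have hsym : trace (Λ.P * (dualAdjP S D.Z₁₁ D.Z₂₁)ᵀ) = trace (Λ.P * dualAdjP S D.Z₁₁ D.Z₂₁) := by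
      rw [← Matrix.trace_transpose, Matrix.transpose_mul, Matrix.transpose_transpose, Λ.P_symm,
        Matrix.trace_mul_comm]
    rw [Matrix.mul_add, Matrix.trace_add, hsym] at h2
    linarith
  have hη : 0 < Λ.η * trace D.Z₁₁ := mul_pos Λ.η_pos D.trace_pos
  have hτ : 0 ≤ ∑ k, Λ.τ k * dualSectorCoeff S D.Z₁₁ D.Z₂₁ D.Z₂₂ Λ.a Λ.b k :=
    Finset.sum_nonneg fun k _ =>
      mul_nonneg (Λ.τ_nonneg k) (D.sectorCoeff_nonneg_of_null_or_slopes k (hab k))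
  have hl : 0 ≤ ∑ k, Λ.lam k * dualPopovCoeff S D.Z₂₁ D.Z₂₂ k := by
    refine Finset.sum_nonneg fun k _ => ?_
    rcases (Λ.lam_nonneg k).eq_or_lt with h0 | hpos
    · rw [← h0, zero_mul]
    · rcases hab k with hnull | ⟨ha, -⟩
      · rw [hnull.2.2.2, mul_zero]
      · exact mul_nonneg hpos.le
          (D.popovCoeff_nonneg k ((Λ.a_nonneg_of_lam_pos k hpos).trans ha))
  linarith

/-- **Window form with null channels** (what a directed-presentation instance states): on every
non-null channel the window `|ξ − δ*_k| ≤ γ_k` contains angles `ξa_k`, `ξb_k` with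
`cos ξa_k ≤ a₀_k`, `b₀_k ≤ cos ξb_k`; then no certificate of the typed class satisfies the sector
hypothesis of `well_subset_regionOfAttraction` for the window `γ` (nor, by monotonicity of that
hypothesis in `γ`, for any wider window).
[cite: BoydVandenberghe2004, §5.9.4 eqs. (5.97)–(5.98) and Example 5.14; Pai1981, §4.6 p. 117] -/
theorem false_of_dualWitness_of_window_of_null {a₀ b₀ : κ → ℝ} (D : SlabDualWitness S a₀ b₀)
    {γ : κ → ℝ}
    (hsec : ∀ k ξ, |ξ - S.δs k| ≤ γ k → Λ.a k ≤ Real.cos ξ ∧ Real.cos ξ ≤ Λ.b k)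
    (ξa ξb : κ → ℝ)
    (hwin : ∀ k, D.IsNull k ∨
      (|ξa k - S.δs k| ≤ γ k ∧ |ξb k - S.δs k| ≤ γ k ∧
        Real.cos (ξa k) ≤ a₀ k ∧ b₀ k ≤ Real.cos (ξb k))) : False := by
  refine Λ.false_of_dualWitness_of_null D fun k => ?_
  rcases hwin k with h | ⟨hξa, hξb, hca, hcb⟩
  · exact Or.inl h
  · exact Or.inr ⟨((hsec k (ξa k) hξa).1).trans hca, hcb.trans (hsec k (ξb k) hξb).2⟩

end SlabCertificate

/-! ## §5 Window points from rational tests (APPEND 2026-08-27, lit-6 g6): the instance's glue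

For a channel with `Y cos δ* = m`, `Y sin δ* = n` (`Y > 0`; `m, n` rational on the typed objects) and a
window `γ` with `cos γ = c`, `sin γ = s` rational (`γ = 2·arctan u`), the two window points the
emptiness theorem wants are `δ* ± γ`, with `Y cos(δ* ± γ) = m c ∓ n s`; choosing the sign by the sign of
`n` gives `Y cos ξa = m c − |n| s` and `Y cos ξb = m c + |n| s` WITHOUT any enclosure of `δ*`, and the
comparisons with the witness slopes `a₀ ≥ 0`, `b₀` become closed RATIONAL inequalities after squaring
(the reverse direction of the positive lane's `sector_of_tests`).  For a window containing `0`
(`|δ*| ≤ γ`, tested as `c·Y ≤ m`) the point `ξb = 0` gives `b₀ ≤ 1`. -/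

section WindowPoints

omit [Fintype ι] [Fintype κ] [DecidableEq ι] [DecidableEq κ]

/-- The low window point: `∃ ξ, |ξ − δ| ≤ γ ∧ cos ξ ≤ a₀` from `Y cos δ = m`, `Y sin δ = n`, `Y > 0`,
`cos γ = c`, `sin γ = s`, `γ ≥ 0`, `a₀ ≥ 0` and the rational test
`m c − |n| s ≤ 0 ∨ (m c − |n| s)² ≤ a₀² Y²` (i.e. `cos(|δ| + γ) ≤ a₀`).
[cite: Pai1981, §4.6 p. 117 (sector bounds of the power nonlinearity on an angle window); VuTuritsyn2017, §4.1 eq. (bound)] -/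
theorem exists_window_point_cos_le {δ γ Y m n c s a₀ : ℝ} (hY : 0 < Y) (hm : Y * Real.cos δ = m)
    (hn : Y * Real.sin δ = n) (hc : Real.cos γ = c) (hs : Real.sin γ = s) (hγ : 0 ≤ γ)
    (ha0 : 0 ≤ a₀) (hlo : m * c - |n| * s ≤ 0 ∨ (m * c - |n| * s) ^ 2 ≤ a₀ ^ 2 * Y ^ 2) :
    ∃ ξ, |ξ - δ| ≤ γ ∧ Real.cos ξ ≤ a₀ := by
  -- the point `δ + γ` if `n ≥ 0`, `δ − γ` otherwise: `Y cos ξ = m c − |n| s`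
  obtain ⟨ξ, hξ, hval⟩ : ∃ ξ, |ξ - δ| ≤ γ ∧ Y * Real.cos ξ = m * c - |n| * s := by
    rcases le_or_gt 0 n with hn0 | hn0
    · refine ⟨δ + γ, by simp [abs_of_nonneg hγ], ?_⟩
      rw [abs_of_nonneg hn0, Real.cos_add, mul_sub, ← mul_assoc, ← mul_assoc, hm, hn, hc, hs]
    · refine ⟨δ - γ, by simp [abs_of_nonneg hγ], ?_⟩
      rw [abs_of_neg hn0, Real.cos_sub, mul_add, ← mul_assoc, ← mul_assoc, hm, hn, hc, hs]; ring
  refine ⟨ξ, hξ, ?_⟩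
  -- `Y cos ξ ≤ a₀ Y`
  have hle : Y * Real.cos ξ ≤ a₀ * Y := by
    rw [hval]
    rcases hlo with h | h
    · exact h.trans (mul_nonneg ha0 hY.le)
    · have h' : (m * c - |n| * s) ^ 2 ≤ (a₀ * Y) ^ 2 := by rw [mul_pow]; exact h
      exact (le_abs_self _).trans (abs_le_of_sq_le_sq h' (mul_nonneg ha0 hY.le))
  nlinarith

/-- The high window point: `∃ ξ, |ξ − δ| ≤ γ ∧ b₀ ≤ cos ξ`, either `ξ = 0` for a window containing `0`
(`b₀ ≤ 1`, `|δ| ≤ π`, `γ ≤ π`, and `c·Y ≤ m` tested as `0 ≤ m`, `c² Y² ≤ m²`), or `ξ = δ ∓ γ`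
with `Y cos ξ = m c + |n| s ≥ 0` and `b₀ ≤ 0 ∨ b₀² Y² ≤ (m c + |n| s)²` (i.e. `b₀ ≤ cos(|δ| − γ)`).
[cite: Pai1981, §4.6 p. 117; VuTuritsyn2017, §4.1 eq. (bound)] -/
theorem exists_window_point_le_cos {δ γ Y m n c s b₀ : ℝ} (hY : 0 < Y) (hm : Y * Real.cos δ = m)
    (hn : Y * Real.sin δ = n) (hc : Real.cos γ = c) (hs : Real.sin γ = s) (hγ : 0 ≤ γ)
    (hhi : (b₀ ≤ 1 ∧ |δ| ≤ Real.pi ∧ γ ≤ Real.pi ∧ 0 ≤ m ∧ c ^ 2 * Y ^ 2 ≤ m ^ 2) ∨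
      (0 ≤ m * c + |n| * s ∧ (b₀ ≤ 0 ∨ b₀ ^ 2 * Y ^ 2 ≤ (m * c + |n| * s) ^ 2))) :
    ∃ ξ, |ξ - δ| ≤ γ ∧ b₀ ≤ Real.cos ξ := by
  rcases hhi with ⟨hb1, hδπ, hγπ, hm0, hsq⟩ | ⟨hB0, hb⟩
  · -- wide window: `cos |δ| = m / Y ≥ c = cos γ`, hence `|δ| ≤ γ`, and `ξ = 0` works
    refine ⟨0, ?_, by rw [Real.cos_zero]; exact hb1⟩
    rw [zero_sub, abs_neg]
    have hcY : c * Y ≤ m := by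
      have h' : (c * Y) ^ 2 ≤ m ^ 2 := by rw [mul_pow]; exact hsq
      exact (le_abs_self _).trans (abs_le_of_sq_le_sq h' hm0)
    have hcos : Real.cos γ ≤ Real.cos |δ| := by
      rw [Real.cos_abs, hc]
      have : c * Y ≤ Y * Real.cos δ := by rw [hm]; exact hcY
      nlinarith
    by_contra hlt
    have := Real.cos_lt_cos_of_nonneg_of_le_pi hγ hδπ (lt_of_not_ge hlt)
    linarith
  · obtain ⟨ξ, hξ, hval⟩ : ∃ ξ, |ξ - δ| ≤ γ ∧ Y * Real.cos ξ = m * c + |n| * s := by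
      rcases le_or_gt 0 n with hn0 | hn0
      · refine ⟨δ - γ, by simp [abs_of_nonneg hγ], ?_⟩
        rw [abs_of_nonneg hn0, Real.cos_sub, mul_add, ← mul_assoc, ← mul_assoc, hm, hn, hc, hs]
      · refine ⟨δ + γ, by simp [abs_of_nonneg hγ], ?_⟩
        rw [abs_of_neg hn0, Real.cos_add, mul_sub, ← mul_assoc, ← mul_assoc, hm, hn, hc, hs]; ring
    refine ⟨ξ, hξ, ?_⟩
    have hle : b₀ * Y ≤ Y * Real.cos ξ := by
      rw [hval]
      rcases hb with h | h
      · exact (mul_nonpos_of_nonpos_of_nonneg h hY.le).trans hB0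
      · rcases le_or_gt 0 b₀ with hb0 | hb0
        · have h' : (b₀ * Y) ^ 2 ≤ (m * c + |n| * s) ^ 2 := by rw [mul_pow]; exact h
          exact (le_abs_self _).trans (abs_le_of_sq_le_sq h' hB0)
        · exact (mul_nonpos_of_nonpos_of_nonneg hb0.le hY.le).trans hB0
    nlinarith

end WindowPoints

namespace SlabCertificate

variable {S : System ι κ} (Λ : SlabCertificate S)

/-- **Window form with per-channel existential window points** (the shape the rational tests of
`exists_window_point_cos_le` / `exists_window_point_le_cos` deliver): every channel is either NULL
for the witness or has window points `ξa`, `ξb` with `cos ξa ≤ a₀_k`, `b₀_k ≤ cos ξb`; then no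
certificate of the typed class satisfies the sector hypothesis for the window `γ`.
[cite: BoydVandenberghe2004, §5.9.4 eqs. (5.97)–(5.98) and Example 5.14; Pai1981, §4.6 p. 117] -/
theorem false_of_dualWitness_of_exists_window {a₀ b₀ : κ → ℝ} (D : SlabDualWitness S a₀ b₀)
    {γ : κ → ℝ}
    (hsec : ∀ k ξ, |ξ - S.δs k| ≤ γ k → Λ.a k ≤ Real.cos ξ ∧ Real.cos ξ ≤ Λ.b k)
    (hwin : ∀ k, D.IsNull k ∨
      ((∃ ξ, |ξ - S.δs k| ≤ γ k ∧ Real.cos ξ ≤ a₀ k) ∧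
        ∃ ξ, |ξ - S.δs k| ≤ γ k ∧ b₀ k ≤ Real.cos ξ)) : False := by
  refine Λ.false_of_dualWitness_of_null D fun k => ?_
  rcases hwin k with h | ⟨⟨ξa, hξa, hca⟩, ξb, hξb, hcb⟩
  · exact Or.inl h
  · exact Or.inr ⟨((hsec k ξa hξa).1).trans hca, hcb.trans (hsec k ξb hξb).2⟩

end SlabCertificate

end Literature.MathematicalPhysics.PowerSystems.LyapunovFunctionFamily
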